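import Summits.CriticalPhenomena.PercolationContinuityZ3.Theorems.Transplant.SkelFrmFrom1HoldsAll
import Summits.CriticalPhenomena.PercolationContinuityZ3.Theorems.Transplant.PlanarSkeletonFrmScaledRayStrict
import Summits.CriticalPhenomena.PercolationContinuityZ3.Theorems.Transplant.PlanarSkeletonFrmScaledDefs
import HarnessLib

/-!
# «CylStrict-From» (follow-up row authorised by RULING W2-WORDS (3), lead g21 2026-08-26; design owner p3 g27 2026-08-27): **Φ2 AT `p_c` IS AUTOMATIC FOR
# EVERY `PlanarSkeletonFrmFrom`, hence THE U NODE IN SKELETON-ONLY FORM** — `θ_t(p_c) = 0` (indeed `θ_v(p_c) = 0` at every vertex) on every locally finite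
# graph carrying a one-type frames-only skeleton with cylinders connected from width `ℓ₀` on, with NO further hypothesis

builds on p205010 (kernel theorem, internal audit signed; external expert review pending).  Lane `prim-bschramm`, seat `prim-bschramm-p3` gen 27; helper file
(`--supports stmt-CriticalPhenomena-4575 --as helper`).  WHY IT IS SHORT (the lead's estimate '≈ 22 modules, ℓ₀-threaded port of the `PlanarSkeletonFrm` CylStrict
cone' predates p5-g26's scaled-carrier ray machinery of 2026-08-26): «PlanarSkeletonFrmScaledRayStrict» proves `PlanarSkeletonFrmScaled.cylSubcritical_criticalProb`
for EVERY scaled skeleton (any number of types, any `L`, `N`, cylinders connected from `ℓ₀` on — Aizenman–Grimmett essential enhancement along rays), and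
«PlanarSkeletonFrmScaledDefs» embeds every `PlanarSkeletonFrmFrom` as a `PlanarSkeletonFrmScaled` with `L = N = 1` (`toFrmScaled`, same cylinders,
`cylSubcritical_toFrmScaled_iff`).  So: §1 `PlanarSkeletonFrmFrom.cylSubcritical_criticalProb` (2 lines); §2 the normal form
`samePDropOfSkeletonFrmFrom₁_iff_skeleton_only` (U ⟺ `θ_t(p_c) = 0` for every one-type `PlanarSkeletonFrmFrom`, nothing else) from «SkelFrmFrom1Closure»
`samePDropOfSkeletonFrmFrom₁_iff_minimal'`; §3 the DISCHARGED forms from the U node «SkelFrmFrom1HoldsAll» p464817: `frmFrom₁CriticalContinuity_skeletonOnly_holds`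
(at the base type) and `…_ray` (at every vertex, frames being automorphisms).  No new mathematics.
[cite: BenjaminiSchramm1996, Conj. 4] [cite: AizenmanGrimmett1991, Thm 1 (essential enhancements)] [cite: GrimmettPercolation1999, §7.1 (7.1) p. 146]
[cite: Hutchcroft2016, Thm. 1] [cite: LyonsPeres2016, Thm. 7.6]
-/

noncomputable section

namespace Summit.CriticalPhenomena.PercolationContinuityZ3.Theorems

namespace Transplant

open MeasureTheory Literature.Probability.Percolation Literature.Probability.LatticeModels SimpleGraph
open Literature.Barriers.CriticalPhenomena (countable_of_connected_of_locallyFinite)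
open scoped Classical

/-! ## §1 Φ2 at `p_c` for every `PlanarSkeletonFrmFrom` -/

namespace PlanarSkeletonFrmFrom

variable {V : Type} {G : SimpleGraph V} [G.LocallyFinite]

/-- **Φ2 AT `p_c` FOR EVERY `PlanarSkeletonFrmFrom`** — any number of types, no further input: every cylinder at every base vertex is subcritical at
`p_c(G)` (the scaled carrier's ray theorem through `toFrmScaled`). [cite: AizenmanGrimmett1991, Thm 1 (essential enhancements)] -/
theorem cylSubcritical_criticalProb (Φ : PlanarSkeletonFrmFrom G) (t₀ : V) : Φ.CylSubcritical (criticalProbIOf G t₀) :=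
  (Φ.cylSubcritical_toFrmScaled_iff (criticalProbIOf G t₀)).1 (Φ.toFrmScaled.cylSubcritical_criticalProb t₀)

end PlanarSkeletonFrmFrom

/-! ## §2 The U node in skeleton-only form -/

/-- **NORMAL FORM OF U WITH NO HYPOTHESIS LEFT**: `SamePDropOfSkeletonFrmFrom₁` is EQUIVALENT to `θ_t(p_c(G,t)) = 0` for EVERY locally finite graph
carrying a `PlanarSkeletonFrmFrom` with one base-vertex type `t` — connectedness, countability, `p_c < 1`, uniqueness (minimal form, «SkelFrmFrom1Closure»)
AND NOW Φ2 at `p_c` (§1) all come from the skeleton. [cite: BenjaminiSchramm1996, Conj. 4] [cite: AizenmanGrimmett1991, Thm 1] -/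
theorem samePDropOfSkeletonFrmFrom₁_iff_skeleton_only : SamePDropOfSkeletonFrmFrom₁ ↔
    ∀ {V : Type} (G : SimpleGraph V) [G.LocallyFinite] (Φ : PlanarSkeletonFrmFrom G), ∀ t ∈ Φ.types, Φ.types = {t} →
      theta G t (criticalProbIOf G t) = 0 := by
  rw [samePDropOfSkeletonFrmFrom₁_iff_minimal']
  exact ⟨fun h V G _ Φ t ht h1 => h G Φ t ht h1 (Φ.cylSubcritical_criticalProb t), fun h V G _ Φ t ht h1 _ => h G Φ t ht h1⟩

/-! ## §3 Discharged by the U node -/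

/-- **THE U NODE, SKELETON-ONLY, HOLDS**: `θ_t(p_c(G,t)) = 0` for every locally finite graph carrying a one-type `PlanarSkeletonFrmFrom` — NOTHING ELSE ASSUMED.
builds on p205010 (kernel theorem, internal audit signed; external expert review pending). [cite: BenjaminiSchramm1996, Conj. 4] -/
theorem frmFrom₁CriticalContinuity_skeletonOnly_holds {V : Type} (G : SimpleGraph V) [G.LocallyFinite] (Φ : PlanarSkeletonFrmFrom G) (t : V)
    (ht : t ∈ Φ.types) (h1 : Φ.types = {t}) : theta G t (criticalProbIOf G t) = 0 :=
  frmFrom₁CriticalContinuity_minimal_holds G Φ t ht h1 (Φ.cylSubcritical_criticalProb t)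

/-- **… AT EVERY VERTEX**: `θ_v(p_c(G,v)) = 0` for every vertex `v` of a locally finite graph carrying a one-type `PlanarSkeletonFrmFrom` (frames are
automorphisms: `θ` and `p_c` are transported from the base vertex).
builds on p205010 (kernel theorem, internal audit signed; external expert review pending). [cite: BenjaminiSchramm1996, Conj. 4] -/
theorem frmFrom₁CriticalContinuity_skeletonOnly_holds_ray {V : Type} (G : SimpleGraph V) [G.LocallyFinite] (Φ : PlanarSkeletonFrmFrom G) (t : V)
    (ht : t ∈ Φ.types) (h1 : Φ.types = {t}) (v : V) : theta G v (criticalProbIOf G v) = 0 := by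
  haveI : Countable V := countable_of_connected_of_locallyFinite G (Φ.graph_connected t) t
  have hbase := frmFrom₁CriticalContinuity_skeletonOnly_holds G Φ t ht h1
  obtain ⟨t', ht', α, hαt, -⟩ := Φ.toFrmScaled.frame v
  rw [PlanarSkeletonFrmFrom.toFrmScaled_types, h1, Finset.mem_singleton] at ht'
  subst ht'
  have hθ := theta_iso α t' (criticalProbIOf G t')
  have hpc := criticalProb_iso α t'
  rw [hαt] at hθ hpc
  have e : criticalProbIOf G v = criticalProbIOf G t' := Subtype.ext hpc
  rw [e, hθ]
  exact hbase

end Transplant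

end Summit.CriticalPhenomena.PercolationContinuityZ3.Theorems

end
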